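import Summits.Ventures.DiscreteObjects.PP12.OrderElevenHomologyWalkSound
import Summits.Ventures.DiscreteObjects.PP12.OrderElevenHomologyOrbit
import Summits.Ventures.DiscreteObjects.PP12.OrderElevenHomologyScanA
import Summits.Ventures.DiscreteObjects.PP12.OrderElevenHomologyScanB
import Summits.Ventures.DiscreteObjects.PP12.OrderElevenHomologyScanC
import Summits.Ventures.DiscreteObjects.PP12.OrderElevenHomologyScanD
import Summits.Ventures.DiscreteObjects.PP12.OrderElevenHomologyScanE

/-!
# PP(12), order-11 cell, Case A: **`NoHomologyArray12`** — assembly of the kernel certificate (designs g22; file LAST, after WalkSound is proved and every import is built)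
Framing: lottery ticket; floor = certified bounds/negative ranges.

Cell pub-namedobj (venture DiscreteObjects), target (M), P11-SIZING.md. A normal array `a` (OrderElevenHomologyNormal) has its packed row `1` in `CANDS2`
(`packRow_one_mem`); the orbit map (`exists_rep_of_umapOK`) gives a unit `u` with `actP u u⁻¹ (packRow a 1) = REPS[k]`; `mulAct u a` is normal
(`IsNormal.mulAct`) with packed row `1` equal to that representative (`packRow_mulAct_one`) and packed row `2` in `CANDS3` (`packRow_two_mem`); but every
representative is blocked (`scan_00 … scan_18` in OrderElevenHomologyScanA…E, `blockedAll_of_slices`, `false_of_blockedAll`). Hence no normal array, and `noHomologyArray12_of_normal` gives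
**`noHomologyArray12 : NoHomologyArray12`** — Case A of the order-11 cell of PP(12) (Janko–van Trung 1982) in the kernel. No `sorry`, no new axioms.
-/

set_option maxRecDepth 100000

namespace Summit.Ventures.DiscreteObjects.PP12

namespace Homology12

/-- all 363 representatives are blocked (the 19 scan declarations) -/
theorem reps_blocked : blockedAll REPS CANDS3 = true :=
  blockedAll_of_slices 19 reps_length fun k hk => by
    interval_cases k
    exacts [scan_00, scan_01, scan_02, scan_03, scan_04, scan_05, scan_06, scan_07, scan_08, scan_09, scan_10, scan_11, scan_12, scan_13, scan_14,
      scan_15, scan_16, scan_17, scan_18]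

/-- **no normal homology array** -/
theorem no_normal (a : Fin 12 → Fin 12 → ZMod 11) (ha : IsNormal a) : False := by
  obtain ⟨u, k, hu1, hu2, hact, hk⟩ := exists_rep_of_umapOK (packRow_one_mem ha)
  have hu0 : ((u : ℕ) : ZMod 11) ≠ 0 := by
    intro h
    have := (ZMod.natCast_eq_zero_iff u 11).1 h
    omega
  have hbN : IsNormal (mulAct hu0 a) := ha.mulAct hu0
  have hrow1 : packRow (mulAct hu0 a) 1 ∈ REPS := by
    rw [packRow_mulAct_one a hu1 hu2 hu0, hact, List.getD_eq_getElem _ _ hk]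
    exact List.getElem_mem hk
  exact false_of_blockedAll reps_blocked hbN hrow1 (packRow_two_mem hbN)

/-- **Case A of the order-11 cell of PP(12): there is no `(11,13;1,1;1)` quasi-difference matrix — no projective plane of order 12 with a homology of order 11** -/
theorem noHomologyArray12 : NoHomologyArray12 := noHomologyArray12_of_normal no_normal

end Homology12

end Summit.Ventures.DiscreteObjects.PP12
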